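import Summits.ResolutionOfSingularities.ResolutionOfSingularities.Theorems.EquisingularLiftEquisingularLiftNatNDInvariants
import HarnessLib

/-!
# [OURS · L1 W4.5(b) · EL♮(3)] LOCAL ND FRAME DATA ⇒ THE STALK IS REGULAR — `…NatNDFrameRegular` (K-REG AUDIT R0, desk DEAL 2026-08-28T16:16:38Z;
# memo `L/res-L1-w45b-iso-w1/KREG-AUDIT-v1.md`)

OURS · L1 W4.5(b) · EL♮(3) stmt-ResolutionOfSingularities-20148 (parent EL♮ stmt-…-20038) · counted 0 · AI-written (res-L1-w45b-iso-w1 g0), weaker than expert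
review; nothing of [Hironaka2017] asserted; no statement of the manuscript.  Sorry-free, def-free, standard axioms, no instance, no notation.
`--supports stmt-ResolutionOfSingularities-20148 --as helper`: support for the «ND-LEAVES» programme (desk R33 (β), SPEC K6): the k-side round machinery of
✓ p647090 needs regularity of a k-stage only AT THE ROUND POINTS, and that is implied by the frame data the invariant `ND.NDInv` already carries — so the
GLOBAL conjunct `Scheme.IsRegular F` can be localised away (audit verdict (i)).
* `isRegularLocalRing_of_span_range_eq` — a Noetherian local ring whose maximal ideal is generated by `n = dim` elements is regular
  (Mathlib `IsRegularLocalRing.of_spanFinrank_maximalIdeal_le`).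
* `isRegularLocalRing_of_isNDFrameAt` (alias `isRegularLocalRing_stalk_of_isNDFrameAt`, desk R36 token) — `ND.IsNDFrameAt n k ρ T W x` on a locally Noetherian `F`
  ⇒ `IsRegularLocalRing (F.presheaf.stalk x)`.
-/

set_option linter.dupNamespace false

noncomputable section

open CategoryTheory AlgebraicGeometry TopologicalSpace IsLocalRing
open Literature.AlgebraicGeometry.Resolution

namespace Summit.ResolutionOfSingularities.ResolutionOfSingularities.Cruxes.EquisingularLiftNat.Sections.ND

/-- R0 (ring form): a Noetherian local ring whose maximal ideal is generated by `n = dim` elements is regular. [OURS · folklore] -/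
theorem isRegularLocalRing_of_span_range_eq {R : Type} [CommRing R] [IsLocalRing R] [IsNoetherianRing R] {n : ℕ}
    (w : Fin n → R) (h2 : Ideal.span (Set.range w) = maximalIdeal R) (h3 : ringKrullDim R = (n : WithBot ℕ∞)) :
    IsRegularLocalRing R := by
  apply IsRegularLocalRing.of_spanFinrank_maximalIdeal_le
  rw [h3, ← h2]
  have hfin : (Set.range w).Finite := Set.finite_range w
  have h := Submodule.spanFinrank_span_le_ncard_of_finite (R := R) (M := R) hfin
  have hcard : (Set.range w).ncard ≤ n := by
    calc (Set.range w).ncard ≤ (Set.univ : Set (Fin n)).ncard := by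
          rw [← Set.image_univ]; exact Set.ncard_image_le (Set.finite_univ)
      _ = n := by rw [Set.ncard_univ, Nat.card_eq_fintype_card, Fintype.card_fin]
  exact_mod_cast h.trans hcard

/-- R0 (scheme form): `IsNDFrameAt` data at `x` on a locally Noetherian `F` ⇒ `𝒪_{F,x}` regular — so the k-side never needs GLOBAL `Scheme.IsRegular F`. [OURS] -/
theorem isRegularLocalRing_of_isNDFrameAt (n : ℕ) (k : Type) [Field k] {F : Scheme.{0}} [IsLocallyNoetherian F]
    {ρ : F ⟶ (Literature.AlgebraicGeometry.Motives.projectiveSpace n k).left} {T : Set F} {W : Fin n → F.IdealSheafData} {x : F}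
    (h : IsNDFrameAt n k ρ T W x) : IsRegularLocalRing (F.presheaf.stalk x) := by
  obtain ⟨w, -, -, h2, h3, -, -⟩ := h
  exact isRegularLocalRing_of_span_range_eq w h2 h3

/-- Alias of `isRegularLocalRing_of_isNDFrameAt` under the desk's R36 token `isRegularLocalRing_stalk_of_isNDFrameAt`. [OURS] -/
theorem isRegularLocalRing_stalk_of_isNDFrameAt (n : ℕ) (k : Type) [Field k] {F : Scheme.{0}} [IsLocallyNoetherian F]
    {ρ : F ⟶ (Literature.AlgebraicGeometry.Motives.projectiveSpace n k).left} {T : Set F} {W : Fin n → F.IdealSheafData} {x : F}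
    (h : IsNDFrameAt n k ρ T W x) : IsRegularLocalRing (F.presheaf.stalk x) :=
  isRegularLocalRing_of_isNDFrameAt n k h

end Summit.ResolutionOfSingularities.ResolutionOfSingularities.Cruxes.EquisingularLiftNat.Sections.ND

end
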